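import Mathlib.Algebra.Group.Hom.Basic
import Mathlib.Algebra.Order.Floor.Defs
import Mathlib.Data.Fintype.Order
import Mathlib.Algebra.Order.Archimedean.Real.Basic
import Mathlib.GroupTheory.Finiteness
import Mathlib.GroupTheory.QuotientGroup.Defs
import HarnessLib

/-!
# The descent theorem (Silverman, *The Arithmetic of Elliptic Curves*, Thm. VIII.3.1)

The abstract "infinite descent" step of the Mordell–Weil theorem: an abelian group `A` carrying a
real-valued (height) function `h` with

* (i) for every `Q ∈ A` a constant `C₁ = C₁(A, Q)` with `h(P + Q) ≤ 2 h(P) + C₁` for all `P`;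
* (ii) an integer `m ≥ 2` and a constant `C₂ = C₂(A)` with `h(m P) ≥ m² h(P) - C₂` for all `P`;
* (iii) for every `C₃` the set `{P ∈ A | h(P) ≤ C₃}` is finite;

and such that `A / m A` is finite, is finitely generated. This is the named fact
`descent_theorem` (a `Prop`), proved here as `descent_theorem_holds` following the printed proof:
every `P` is a `ℤ`-combination of coset representatives `Q₁, …, Q_r` of `A / m A` and of a point of
height `≤ 1 + (C₁' + C₂)/2`.

## References

* J. H. Silverman, *The Arithmetic of Elliptic Curves*, 2nd ed., GTM 106, Springer 2009,
  §VIII.3 "The descent procedure", Theorem VIII.3.1 (Descent theorem). [SilvermanAEC2009]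
-/

namespace MordellWeil

/-- **Descent theorem** (Silverman AEC Thm. VIII.3.1). Let `A` be an abelian group and
`h : A → ℝ` a function such that (i) for each `Q ∈ A` there is `C₁` with
`h (P + Q) ≤ 2 h P + C₁` for all `P`; (ii) there are an integer `m ≥ 2` and `C₂` with
`h (m • P) ≥ m² h P - C₂` for all `P`; (iii) for every `C₃`, `{P | h P ≤ C₃}` is finite. If moreover
`A / m A` is finite (`m A` = range of multiplication by `m`), then `A` is finitely generated.
[cite: SilvermanAEC2009, Thm. VIII.3.1] -/
def descent_theorem : Prop :=
  ∀ (A : Type*) [AddCommGroup A] (h : A → ℝ) (m : ℕ), 2 ≤ m →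
    (∀ Q : A, ∃ C₁ : ℝ, ∀ P : A, h (P + Q) ≤ 2 * h P + C₁) →
    (∃ C₂ : ℝ, ∀ P : A, (m : ℝ) ^ 2 * h P - C₂ ≤ h (m • P)) →
    (∀ C₃ : ℝ, {P : A | h P ≤ C₃}.Finite) →
    Finite (A ⧸ (nsmulAddMonoidHom m : A →+ A).range) →
    AddGroup.FG A

/-- Proof of the descent theorem `descent_theorem` (Silverman AEC Thm. VIII.3.1), following the
printed proof: writing `P = m P₁ + Q_{i₁}`, `P₁ = m P₂ + Q_{i₂}`, … the heights drop until
`h(P_n) ≤ C`, so `A` is generated by the finitely many coset representatives together with the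
finite set `{P | h P ≤ C}`. [cite: SilvermanAEC2009, Thm. VIII.3.1] -/
theorem descent_theorem_holds : descent_theorem := by
  intro A _ h m hm h1 h2 h3 hfin
  classical
  set H : AddSubgroup A := (nsmulAddMonoidHom m : A →+ A).range with hH
  -- coset representatives
  let rep : A ⧸ H → A := Quotient.out
  have hrep : ∀ P : A, ∃ P₁ : A, P = m • P₁ + rep (QuotientAddGroup.mk P) := by
    intro P
    have hq : (QuotientAddGroup.mk (rep (QuotientAddGroup.mk P : A ⧸ H)) : A ⧸ H) =
        QuotientAddGroup.mk P := Quotient.out_eq _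
    rw [QuotientAddGroup.eq] at hq
    obtain ⟨P₁, hP₁⟩ := hq
    refine ⟨P₁, ?_⟩
    simp only [nsmulAddMonoidHom_apply] at hP₁
    rw [hP₁]
    abel
  -- the constant `C₁'`
  have hc : ∀ q : A ⧸ H, ∃ C₁ : ℝ, ∀ P : A, h (P + -rep q) ≤ 2 * h P + C₁ := fun q => h1 _
  choose c hc using hc
  obtain ⟨C₁', hC₁'⟩ := Finite.exists_le c
  obtain ⟨C₂, hC₂⟩ := h2
  -- the height bound
  set C : ℝ := max 0 (1 + (C₁' + C₂) / 2) with hCdef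
  have hC0 : 0 ≤ C := le_max_left _ _
  have hC1 : 1 + (C₁' + C₂) / 2 ≤ C := le_max_right _ _
  -- the generating set
  set S : Set A := Set.range rep ∪ {P : A | h P ≤ C} with hS
  have hSfin : S.Finite := (Set.finite_range rep).union (h3 C)
  -- one descent step
  have hstep : ∀ P : A, ∃ P₁ : A, P = m • P₁ + rep (QuotientAddGroup.mk P) ∧
      (m : ℝ) ^ 2 * h P₁ ≤ 2 * h P + C₁' + C₂ := by
    intro P
    obtain ⟨P₁, hP₁⟩ := hrep P
    refine ⟨P₁, hP₁, ?_⟩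
    have e : P + -rep (QuotientAddGroup.mk P) = m • P₁ := by
      rw [← sub_eq_add_neg, sub_eq_iff_eq_add]; exact hP₁
    have := hC₂ P₁
    rw [← e] at this
    have := hc (QuotientAddGroup.mk P) P
    have := hC₁' (QuotientAddGroup.mk P)
    linarith
  have hm2 : (4 : ℝ) ≤ (m : ℝ) ^ 2 := by
    have : (2 : ℝ) ≤ m := by exact_mod_cast hm
    nlinarith
  -- induction on `N` with `h P ≤ C + N`
  have key : ∀ N : ℕ, ∀ P : A, h P ≤ C + N → P ∈ AddSubgroup.closure S := by
    intro N
    induction N with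
    | zero =>
      intro P hP
      refine AddSubgroup.subset_closure (Or.inr ?_)
      simpa using hP
    | succ N ih =>
      intro P hP
      obtain ⟨P₁, hP₁, hh⟩ := hstep P
      have hQ : rep (QuotientAddGroup.mk P) ∈ AddSubgroup.closure S :=
        AddSubgroup.subset_closure (Or.inl ⟨_, rfl⟩)
      have hP₁mem : P₁ ∈ AddSubgroup.closure S := by
        by_cases hle : h P₁ ≤ C
        · exact AddSubgroup.subset_closure (Or.inr hle)
        · apply ih
          push Not at hle
          have h0 : 0 ≤ h P₁ := hC0.trans hle.le
          push_cast at hP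
          nlinarith
      rw [hP₁]
      exact AddSubgroup.add_mem _ (AddSubgroup.nsmul_mem _ hP₁mem m) hQ
  rw [AddGroup.fg_iff]
  refine ⟨S, ?_, hSfin⟩
  rw [eq_top_iff]
  intro P _
  obtain ⟨N, hN⟩ := exists_nat_ge (h P - C)
  exact key N P (by linarith)

end MordellWeil
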